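import Summits.QuantumFields.YangMills.Theorems.AlphaInputsT3ACv3Reg68LevelsOfFineRegular
import HarnessLib

/-!
# `AlphaInputsT3ACv3Reg68LevelsOfFineRegularRecord` — r-68b IN THE RECORD's THRESHOLD CURRENCY: `U ∈ AlphaInputsT3AC.reg68LevelsSet k h` from regional
# fine regularity at radius `a·θBal(K−i)·L^{−2i}` on `Ω_i(h)` ([Balaban1985Variational] (8): `B₃ε₁(j)`, `ε₁(j) = g_jp(g_j) = θBal(K−j)`), under ONE size
# `2L²·a ≤ C68` and ONE top-level smallness, in the antitone regime of the thresholds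

Cell `ym3-torus` (rung R3 — finite-torus SU(2) YM₃, NOT Clay), seat `ym-ust-19936-w4` (gen 4), WIDTH helper on stmt-QuantumFields-19936 `HistoryTailL`; §3 of
plumbing row **r-68b** of the LEAD's B1 memo (sibling of `AlphaInputsT3ACv3Reg68LevelsOfFineRegular`, split for the 400-line rule).  `--supports
stmt-QuantumFields-19936 --as helper`; def-free; count-neutral.

WHAT.  The sibling's ★ `mem_reg68LevelsSet_of_plaqSmallOn_Omega` displays per-level windows `2L²·α_{i−1} ≤ C68·θBal(K−i)` and per-level Prop.-2 smallness.
With `α_i := a·θBal(K−i)` (the species of print's (8) radius and of the record's rows) and the thresholds ANTITONE (`θBal(j+1) ≤ θBal(j)` for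
`√γ ≤ e^{1−p₀}`, `T3Thresholds.θBal_le_of_le`), these collapse to the record's single size condition `2L²·a ≤ C68` (cf. `C68 ≥ 4B₃L²·B` of
`AlphaInputsT3ACMinimiserPinConsts.C68_dom_of_le`) and the smallness at the top level `k` only (free downward in `γ`):
★ `mem_reg68LevelsSet_of_plaqSmallOn_Omega_θBal`.

HONEST FRAMING.  A corollary of the sibling; nothing of Bałaban's asserted; the stub `stub_laneRecordsV3Chi`, the crux `HistoryTailL`, NODE O d = 3 and B1
are NOT claimed; YM₃ on T³ = rung R3 — not d = 4, not infinite volume, no mass gap, not Clay.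

References: T. Bałaban, CMP 102 (1985) 255–275 [Balaban1985UV3] ((68) p.273); CMP 102 (1985) 277–309 [Balaban1985Variational] ((8) p.279).
-/

set_option autoImplicit false

noncomputable section

namespace Summit.QuantumFields.YangMills.Theorems.Reg68LevelsOfFineRegular

open Literature.MathematicalPhysics.QuantumFieldTheory.Balaban1983to89
open Literature.MathematicalPhysics.QuantumFieldTheory.Balaban1983to89.ExpMeanLog (deltaSU)
open Literature.MathematicalPhysics.QuantumFieldTheory.Balaban1983to89.T3Thresholds (θBal_le_of_le)
open Literature.MathematicalPhysics.QuantumFieldTheory.Balaban1983to89.T3ContinuumYM3Torus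
open Literature.MathematicalPhysics.QuantumFieldTheory.Balaban1983to89.T3UnitScaleTilt (θBal)
open Literature.MathematicalPhysics.QuantumFieldTheory.Balaban1983to89.B10Eq38TorusDomains (plaqsIn)
open Literature.MathematicalPhysics.QuantumFieldTheory.Balaban1985CMP102.Setting
open Summit.QuantumFields.Balaban3D.Carriers
open Summit.QuantumFields.Balaban3D.Proofs.Primitives (AlphaConsts)

section T3

variable (F : T3Family) (𝔠 : AlphaConsts F.L (suGroupModel 2).N) (γ : ℝ) (hγ : 0 < γ) (hγ1 : γ ≤ (min 𝔠.gamma0 1) ^ 2) (K : ℕ)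

/-- **(68) AT EVERY LEVEL, IN THE RECORD's THRESHOLD CURRENCY** `α_i := a·θBal(K−i)` (print: (8)'s radius `B₃ε₁(j)`, `ε₁(j) = g_jp(g_j) = θBal(K−j)`):
in the antitone regime of the thresholds (`√γ ≤ e^{1−p₀}`, `γ ≤ 1`) the level windows collapse to ONE size condition `2L²·a ≤ C68` (the species of the
record's `C68 ≥ 4B₃L²·B`, `AlphaInputsT3ACMinimiserPinConsts.C68_dom_of_le`) and ONE smallness at the top level `k`
(`C₀(3)·L²·a·θBal(K−k) ≤ ⅓`, `2L²·a·θBal(K−k) ≤ 2δ₂∕(7L)²` — free downward in `γ`). [cite: Balaban1985UV3, (68) p.273; Balaban1985Variational, (8) p.279] -/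
theorem mem_reg68LevelsSet_of_plaqSmallOn_Omega_θBal {k : ℕ} (hk : k ≤ K) (h : Hist (F.P K) k)
    {U : GaugeField (F.P K) 0 (Matrix.specialUnitaryGroup (Fin 2) ℂ)} {a : ℝ} (ha : 0 < a) (hγone : γ ≤ 1)
    (hγe : Real.sqrt γ ≤ Real.exp (1 - 𝔠.p₀))
    (hU : ∀ i, i ≤ k → PlaqSmallOn (↑(plaqsIn 0 (Omega 𝔠.lane.carrier.M₁
        (rcolOf (T3Scales F γ hγ (hγ1.trans (sq_min_one_le _ 𝔠.gamma0_pos)) K) 𝔠.lane.carrier) k h i)) : Set (Plaq (F.P K) 0))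
        (a * θBal F.L γ 𝔠.b₀ 𝔠.p₀ (K - i) * (((F.L : ℝ) ^ i)⁻¹) ^ 2) U)
    (hsmall : (143 * ((7 : ℝ) ^ 2 / 4) ^ 2) * ((F.L : ℝ) ^ 2 * (a * θBal F.L γ 𝔠.b₀ 𝔠.p₀ (K - k))) ≤ 1 / 3 ∧
        2 * ((F.L : ℝ) ^ 2 * (a * θBal F.L γ 𝔠.b₀ 𝔠.p₀ (K - k))) ≤ 2 * deltaSU (Fin 2) / ((7 * F.L : ℕ) : ℝ) ^ 2)
    (hM₁ : 7 * F.L + 3 ≤ 𝔠.M₁) (hC68 : 2 * (F.L : ℝ) ^ 2 * a ≤ 𝔠.C68) :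
    U ∈ AlphaInputsT3AC.reg68LevelsSet F 𝔠 γ hγ hγ1 K k h := by
  have hL1 : 1 ≤ F.L := le_of_lt F.hL.2
  have hL1r : (1 : ℝ) ≤ (F.L : ℝ) := by exact_mod_cast hL1
  have hθanti : ∀ {i j : ℕ}, i ≤ j → θBal F.L γ 𝔠.b₀ 𝔠.p₀ j ≤ θBal F.L γ 𝔠.b₀ 𝔠.p₀ i := fun hij =>
    θBal_le_of_le hL1 hγ hγone hγe 𝔠.b₀_pos.le 𝔠.p₀_pos.le hij
  have hθpos : ∀ i, 0 < θBal F.L γ 𝔠.b₀ 𝔠.p₀ i := fun i =>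
    Literature.MathematicalPhysics.QuantumFieldTheory.Balaban1983to89.T3MinimiserStabilityReduction.θBal_pos hL1 hγ hγone 𝔠.b₀_pos 𝔠.p₀ i
  refine mem_reg68LevelsSet_of_plaqSmallOn_Omega F 𝔠 γ hγ hγ1 K hk h (α := fun i => a * θBal F.L γ 𝔠.b₀ 𝔠.p₀ (K - i))
    (fun i _ => mul_pos ha (hθpos _)) hU (fun i hi => ?_) hM₁ ?_ (fun i hi1 hik => ?_)
  · -- smallness at level `i` from the top level `k` (antitone thresholds: `θBal(K−i) ≤ θBal(K−k)`)
    have hmono : a * θBal F.L γ 𝔠.b₀ 𝔠.p₀ (K - i) ≤ a * θBal F.L γ 𝔠.b₀ 𝔠.p₀ (K - k) :=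
      mul_le_mul_of_nonneg_left (hθanti (by omega)) ha.le
    have hL2 : (0 : ℝ) ≤ (F.L : ℝ) ^ 2 := by positivity
    have hm2 : (F.L : ℝ) ^ 2 * (a * θBal F.L γ 𝔠.b₀ 𝔠.p₀ (K - i)) ≤ (F.L : ℝ) ^ 2 * (a * θBal F.L γ 𝔠.b₀ 𝔠.p₀ (K - k)) :=
      mul_le_mul_of_nonneg_left hmono hL2
    exact ⟨(mul_le_mul_of_nonneg_left hm2 (by positivity)).trans hsmall.1, by linarith [hsmall.2]⟩
  · -- `i = 0`: `a ≤ 2L²a ≤ C68`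
    show a * θBal F.L γ 𝔠.b₀ 𝔠.p₀ (K - 0) ≤ 𝔠.C68 * θBal F.L γ 𝔠.b₀ 𝔠.p₀ K
    rw [Nat.sub_zero]
    have ha' : a ≤ 𝔠.C68 := by nlinarith [one_le_pow₀ (n := 2) hL1r]
    exact mul_le_mul_of_nonneg_right ha' (hθpos K).le
  · -- `i ≥ 1`: `2L²a·θBal(K−i+1) ≤ C68·θBal(K−i)`
    show 2 * ((F.L : ℝ) ^ 2 * (a * θBal F.L γ 𝔠.b₀ 𝔠.p₀ (K - (i - 1)))) ≤ 𝔠.C68 * θBal F.L γ 𝔠.b₀ 𝔠.p₀ (K - i)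
    have hθ : θBal F.L γ 𝔠.b₀ 𝔠.p₀ (K - (i - 1)) ≤ θBal F.L γ 𝔠.b₀ 𝔠.p₀ (K - i) := hθanti (by omega)
    calc 2 * ((F.L : ℝ) ^ 2 * (a * θBal F.L γ 𝔠.b₀ 𝔠.p₀ (K - (i - 1))))
        = (2 * (F.L : ℝ) ^ 2 * a) * θBal F.L γ 𝔠.b₀ 𝔠.p₀ (K - (i - 1)) := by ring
      _ ≤ 𝔠.C68 * θBal F.L γ 𝔠.b₀ 𝔠.p₀ (K - i) := mul_le_mul hC68 hθ (hθpos _).le 𝔠.C68_pos.le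

end T3

end Summit.QuantumFields.YangMills.Theorems.Reg68LevelsOfFineRegular

end
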